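import Literature.MathematicalPhysics.QuantumFieldTheory.Balaban1983to89.BlockAveragingHaarAC
import Literature.MathematicalPhysics.QuantumFieldTheory.Balaban1983to89.AveragingReflection
import HarnessLib

/-!
# Route `UnitScaleTilt`, crux K1b-INT `FluctuationComparisonRegPrIntL` (stmt-QuantumFields-20520) — S1aᴴ `RunClassMembershipH`, conjuncts (a)∕(c):
# THE CENTRE LEG OF A COARSE BOND IN BAŁABAN'S (0.4) LOOP WORDS — it is traversed by exactly the members whose staircase starts with it,
# once, forward, as their FIRST step; it is a common left factor of their loop variables and invisible to all the others

Cell `ym3-torus` (rung R3: SU(2) YM₃ on T³ — NOT d = 4, NOT infinite volume, NOT a mass gap, NOT Clay), width seat `ym3-torus-px13` g24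
(helper on the crux, `--supports stmt-QuantumFields-20520`, def-free, count-neutral for the registry).  FILE A of the pair
«centre-leg occurrence» ∕ «centre-leg response» (`…S1aCentreLegResponse`).

WHY.  The transversality lemma (T⊥) of UV3-NODE §67.7–§67.9 (px20 g20; the existence half of S1aᴴ's analyticity conjunct (a) and the
continuity conjunct (c) for sharply cut small-field densities of the (0.4) cascade) reduces, in the resampling coordinates of
✓`…SubmersionEngine` (private bonds `β(c)` = the central crossing bonds of `BlockAveragingHaarAC`, solved fibrewise), to ONE analytic
engine: a NON-private bond whose first-order response on `Ū(c)` is onto (px13 g24 cost map, 2026-08-31).  The CENTRE LEG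
`e′ = ⟨emb c₋, ν⟩`, `ν ≠ c.dir` — the first bond out of the block centre along an axis transverse to `c` — is the bond where that response
is a SCALAR: this file proves the lattice-walk facts behind it, FILE B the response letter.

THE PRINT.  T. Bałaban, *Renormalization group approach to lattice gauge field theories. I*, Commun. Math. Phys. **109** (1987) 249–301
[Balaban1987RG1], (0.3)–(0.4) pp. 252–253: the loop words `Γ ∪ [x, x′] ∪ (−Γ′) ∪ (−c)` with staircases `Γ ∈ G(c₋, x)` from the block centre
(tree: `BlockAveraging.loopWord = stairWord σ n ++ (L·(+e_μ) ++ (wordRev (stairWord σ′ n) ++ L·(−e_μ)))`, offsets `|n_ν| ≤ h`, `L = 2h + 1`).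

WHAT THIS FILE PROVES (all [folklore] lattice combinatorics; `Params` arbitrary in the standing range `j + 1 ≤ m + K`; any gauge group):
* §1 `exists_netDisp_take_stairRuns_ne_zero` ∕ `…_stairWord_…` — a non-empty prefix of a staircase has moved (no return to the centre);
  `netDisp_take_loopWord_dir_pos` — every prefix reaching into `−Γ′` has longitudinal displacement `≥ L − h ≥ 1`.
* §2 `exists_index_of_mem_walk` (the position of a step of a walk), `netDisp_take_loopWord_eq_zero_of_walkEnd_eq`
  (a prefix of the loop word that closes ON THE TORUS closes as an integer vector — no wrap-around), `unshift_emb_ne`.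
* §3 ★ `centreLeg_index` — if the `k`-th letter is `±e_ν` and its step issues from `emb c₋`, then `k = 0` and the letter is `+e_ν`;
  `bond_ne_centreLeg_of_mem_walk_tail`, `loopWord_ne_nil`, `loopWord_head_eq_iff`;
  ★★ `loopHol_update_centreLeg` — `loopHol (update U e′ (g·U e′)) c i = g·loopHol U c i` if `(stairWord σ_i n_i).head? = some (ν, true)`, else
  `= loopHol U c i`; `axialAvg_update_centreLeg` (`U(c)` untouched); `dist1_loopHol_update_centreLeg_le`;
  `exists_centreLeg_member` ∕ `one_le_card_centreLeg` (the set of such members is non-empty: `n_ν = h ≥ 1`, `ν` first).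

HONEST SCOPE.  Finite lattice-walk bookkeeping over the tree's `BlockAveraging` ∕ `T4Continuum` vocabulary; no measure, no estimate, nothing of
Bałaban's analysis; (T⊥), S1aᴴ, the five registered stubs of `Lines/semiclassical_s2beta.lean`, crux 20520 and `YM3TorusSU2` are NOT proved;
the Yang–Mills mass gap is NOT proved.
-/

set_option autoImplicit false

noncomputable section

namespace Summit.QuantumFields.YangMills.Theorems.FluctuationComparisonRegPrIntLS1aCentreLegOccurrence

open Literature.MathematicalPhysics.QuantumFieldTheory.Balaban1983to89
open T4Continuum AveragingRT BlockAveraging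

/-! ## §1 Word facts: a staircase never returns to its start; the reverse staircase stays a block away -/

section Words

variable {d : ℕ}

/-- A non-empty prefix of a staircase word through a duplicate-free list of axes has moved: some coordinate of its net
displacement is non-zero (each axis is run through once, monotonically). [folklore] -/
theorem exists_netDisp_take_stairRuns_ne_zero (n : Fin d → ℤ) :
    ∀ (as : List (Fin d)), as.Nodup → ∀ (k : ℕ), 1 ≤ k → k ≤ (stairRuns n as).length →
      ∃ a, netDisp ((stairRuns n as).take k) a ≠ 0
  | [], _, k, hk, hkl => by simp [stairRuns] at hkl; omega
  | a :: as, has, k, hk, hkl => by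
    rw [List.nodup_cons] at has
    by_cases hna : n a = 0
    · have he : stairRuns n (a :: as) = stairRuns n as := by simp [stairRuns, axisRun, hna]
      rw [he] at hkl ⊢
      exact exists_netDisp_take_stairRuns_ne_zero n as has.2 k hk hkl
    · refine ⟨a, ?_⟩
      rw [stairRuns, List.take_append, T4ReflectionCone.netDisp_append,
        netDisp_take_stairRuns_of_not_mem n as a has.1, add_zero, axisRun, netDisp_take_replicate]
      simp only [if_true]
      have hmin : 1 ≤ min k (n a).natAbs := le_min hk (Int.natAbs_pos.mpr hna)
      by_cases h0 : 0 ≤ n a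
      · simp only [h0, decide_true, if_true, mul_one]
        exact_mod_cast (show (min k (n a).natAbs) ≠ 0 by omega)
      · simp only [h0, decide_false, Bool.false_eq_true, if_false, mul_neg_one, ne_eq, neg_eq_zero]
        exact_mod_cast (show (min k (n a).natAbs) ≠ 0 by omega)

/-- The same for the staircase word of an ordering of the axes. [folklore] -/
theorem exists_netDisp_take_stairWord_ne_zero (σ : Equiv.Perm (Fin d)) (n : Fin d → ℤ) {k : ℕ} (hk : 1 ≤ k)
    (hkl : k ≤ (stairWord σ n).length) : ∃ a, netDisp ((stairWord σ n).take k) a ≠ 0 :=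
  exists_netDisp_take_stairRuns_ne_zero n _ (nodup_finRange_map σ) k hk hkl

/-- **Every prefix of the loop word that reaches into the reversed staircase `−Γ′` has longitudinal displacement at least
`L − h ≥ 1`** (`|n_μ| ≤ h`, `L = 2h + 1`): between the transported bond and the closing line the walk is a block away from its
start. [folklore] -/
theorem netDisp_take_loopWord_dir_pos {L h : ℕ} (hL : 2 * h + 1 = L) (μ : Fin d) (n : Fin d → ℤ)
    (hn : ∀ κ, -(h : ℤ) ≤ n κ ∧ n κ ≤ h) (σ σ' : Equiv.Perm (Fin d)) {k : ℕ}
    (hk1 : (stairWord σ n).length + L ≤ k) (hk2 : k ≤ (stairWord σ n).length + L + (wordRev (stairWord σ' n)).length) :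
    0 < netDisp ((loopWord L μ n σ σ').take k) μ := by
  unfold loopWord
  rw [List.take_append, List.take_of_length_le (by omega), T4ReflectionCone.netDisp_append,
    netDisp_stairWord, List.take_append, List.take_of_length_le (by simp; omega),
    T4ReflectionCone.netDisp_append, T4ReflectionCone.netDisp_replicate, List.length_replicate,
    List.take_append, T4ReflectionCone.netDisp_append]
  have ht : k - (stairWord σ n).length - L - (wordRev (stairWord σ' n)).length = 0 := by omega
  rw [ht, List.take_zero, netDisp_nil', add_zero]
  obtain ⟨m, hm⟩ := netDisp_take_wordRev (stairWord σ' n) (k - (stairWord σ n).length - L)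
  rw [hm μ, netDisp_stairWord]
  have h1 := (netDisp_take_stairWord σ' n μ m).1
  have h2 := (hn μ).1
  simp only [if_true, mul_one]
  have : min 0 (n μ) ≥ -(h : ℤ) := le_min (by omega) h2
  omega

end Words

/-! ## §2 Walks: the position of a step; closed prefixes of the loop word do not wrap around the torus -/

section Walks

variable {P : Params} {j : ℕ}

/-- **THE POSITION OF A STEP.**  Every step of the walk spelled by `w` from `x` is the `k`-th letter of `w` for some `k`, issued
from the end of the prefix of length `k` (forward step) resp. `k + 1` (backward step). [folklore] -/
theorem exists_index_of_mem_walk : ∀ (x : Site P j) (w : List (Letter P.d)) (s : LStep P j), s ∈ walk x w →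
    ∃ k, k < w.length ∧ w[k]? = some (s.bond.dir, s.fwd) ∧
      s.bond.src = walkEnd x (w.take (if s.fwd then k else k + 1))
  | _, [], s, hs => by simp [walk] at hs
  | x, (μ, true) :: w, s, hs => by
    simp only [walk, List.mem_cons] at hs
    rcases hs with rfl | hs
    · exact ⟨0, by simp, by simp, by simp [walkEnd]⟩
    · obtain ⟨k, hk, hwk, hsrc⟩ := exists_index_of_mem_walk (x.shift μ) w s hs
      refine ⟨k + 1, by simpa using hk, by simpa using hwk, ?_⟩
      cases hf : s.fwd
      · rw [hf] at hsrc; simpa [walkEnd, List.take_succ_cons] using hsrc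
      · rw [hf] at hsrc; simpa [walkEnd, List.take_succ_cons] using hsrc
  | x, (μ, false) :: w, s, hs => by
    simp only [walk, List.mem_cons] at hs
    rcases hs with rfl | hs
    · exact ⟨0, by simp, by simp, by simp [walkEnd]⟩
    · obtain ⟨k, hk, hwk, hsrc⟩ := exists_index_of_mem_walk (x.unshift μ) w s hs
      refine ⟨k + 1, by simpa using hk, by simpa using hwk, ?_⟩
      cases hf : s.fwd
      · rw [hf] at hsrc; simpa [walkEnd, List.take_succ_cons] using hsrc
      · rw [hf] at hsrc; simpa [walkEnd, List.take_succ_cons] using hsrc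

/-- **NO WRAP-AROUND.**  If a prefix of the loop word at `c` returns to the block centre `emb c₋` ON THE TORUS, its net
displacement vanishes as an integer vector (the prefix box `[-h, L + h]` is shorter than the period `≥ 2L`). [folklore] -/
theorem netDisp_take_loopWord_eq_zero_of_walkEnd_eq (hj : j + 1 ≤ P.m + P.K) (c : PBond P (j + 1)) (i : Idx P) (k : ℕ)
    (h : walkEnd (emb c.src) ((loopWord P.L c.dir (off i.1) i.2.1 i.2.2).take k) = emb c.src) (κ : Fin P.d) :
    netDisp ((loopWord P.L c.dir (off i.1) i.2.1 i.2.2).take k) κ = 0 := by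
  set e : ℤ := netDisp ((loopWord P.L c.dir (off i.1) i.2.1 i.2.2).take k) κ with he
  have hcast : ((e : ℤ) : ZMod (P.sitesPerDir j)) = 0 := by
    have h1 := congrFun h κ
    rw [walkEnd_apply] at h1
    simpa using h1
  have hdvd : ((P.sitesPerDir j : ℕ) : ℤ) ∣ e := (ZMod.intCast_zmod_eq_zero_iff_dvd e _).1 hcast
  have hb := netDisp_take_loopWord (L := P.L) (h := (P.L - 1) / 2) c.dir (off i.1) (off_bounds i.1) i.2.1 i.2.2 k κ
  have hL := two_mul_half_add_one P
  have hN := AveragingReflection.two_mul_L_le_sitesPerDir hj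
  refine Int.eq_zero_of_abs_lt_dvd hdvd ?_
  rw [abs_lt]
  by_cases hμ : c.dir = κ
  · rw [if_pos hμ] at hb; constructor <;> omega
  · rw [if_neg hμ] at hb; constructor <;> omega

/-- `emb y − e_ν ≠ emb y` on the finer torus (its period is at least `2`). [folklore] -/
theorem unshift_emb_ne (hj : j + 1 ≤ P.m + P.K) (y : Site P (j + 1)) (ν : Fin P.d) : (emb y).unshift ν ≠ emb y := by
  intro h
  have h1 := congrFun h ν
  rw [Site.unshift_apply, if_pos rfl] at h1
  have h2 : (1 : ZMod (P.sitesPerDir j)) = 0 := sub_eq_self.mp h1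
  have hN := AveragingReflection.two_mul_L_le_sitesPerDir hj
  have hL := P.L_pos
  have : Fact (1 < P.sitesPerDir j) := ⟨by omega⟩
  exact one_ne_zero h2

/-- **THE CENTRE LEG OCCURS ONLY AS THE FIRST STEP, FORWARD.**  For `ν ≠ c.dir`: if the `k`-th letter of the loop word of member `i`
at `c` is `±e_ν` and the corresponding step issues from the block centre `emb c₋`, then `k = 0` and the letter is `+e_ν` —
inside `Γ` the walk never returns to the centre (§1), on the transported bond and the closing line the letters are `±e_μ`,
and along `−Γ′` the walk is a block away. [folklore] -/
theorem centreLeg_index (hj : j + 1 ≤ P.m + P.K) (c : PBond P (j + 1)) (i : Idx P) {ν : Fin P.d} (hν : ν ≠ c.dir)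
    {k : ℕ} {b : Bool} (hk : (loopWord P.L c.dir (off i.1) i.2.1 i.2.2)[k]? = some (ν, b))
    (hret : walkEnd (emb c.src) ((loopWord P.L c.dir (off i.1) i.2.1 i.2.2).take (if b then k else k + 1)) = emb c.src) :
    k = 0 ∧ b = true := by
  have h0 := netDisp_take_loopWord_eq_zero_of_walkEnd_eq hj c i _ hret
  have hwdef : loopWord P.L c.dir (off i.1) i.2.1 i.2.2 = stairWord i.2.1 (off i.1) ++
      (List.replicate P.L (c.dir, true) ++ (wordRev (stairWord i.2.2 (off i.1)) ++ List.replicate P.L (c.dir, false))) := rfl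
  have hL := two_mul_half_add_one P
  rcases lt_or_ge k (stairWord i.2.1 (off i.1)).length with h1 | h1
  · -- inside the staircase `Γ`
    rw [hwdef, List.getElem?_append_left h1] at hk
    have htake : ∀ k', k' ≤ (stairWord i.2.1 (off i.1)).length →
        (loopWord P.L c.dir (off i.1) i.2.1 i.2.2).take k' = (stairWord i.2.1 (off i.1)).take k' := fun k' hk' => by
      rw [hwdef, List.take_append, Nat.sub_eq_zero_of_le hk', List.take_zero, List.append_nil]
    cases b
    · exfalso
      have hk1 : k + 1 ≤ (stairWord i.2.1 (off i.1)).length := h1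
      obtain ⟨a, ha⟩ := exists_netDisp_take_stairWord_ne_zero i.2.1 (off i.1) (k := k + 1) (by omega) hk1
      refine ha ?_
      have := h0 a
      simp only [Bool.false_eq_true, if_false] at this
      rwa [htake (k + 1) hk1] at this
    · refine ⟨?_, rfl⟩
      by_contra hk0
      obtain ⟨a, ha⟩ := exists_netDisp_take_stairWord_ne_zero i.2.1 (off i.1) (k := k) (by omega) h1.le
      refine ha ?_
      have := h0 a
      simp only [if_true] at this
      rwa [htake k h1.le] at this
  · exfalso
    rw [hwdef, List.getElem?_append_right h1] at hk
    rcases lt_or_ge (k - (stairWord i.2.1 (off i.1)).length) P.L with h2 | h2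
    · -- on the transported bond: the letter is `+e_μ`
      rw [List.getElem?_append_left (by simpa using h2), List.getElem?_replicate] at hk
      simp only [h2, if_true, Option.some.injEq, Prod.mk.injEq] at hk
      exact hν hk.1.symm
    · rw [List.getElem?_append_right (by simpa using h2), List.length_replicate] at hk
      rcases lt_or_ge (k - (stairWord i.2.1 (off i.1)).length - P.L) (wordRev (stairWord i.2.2 (off i.1))).length
        with h3 | h3
      · -- along `−Γ′`: the prefix has positive longitudinal displacement
        have hk1' : (stairWord i.2.1 (off i.1)).length + P.L ≤ (if b then k else k + 1) := by cases b <;> simp <;> omega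
        have hk2' : (if b then k else k + 1) ≤ (stairWord i.2.1 (off i.1)).length + P.L +
            (wordRev (stairWord i.2.2 (off i.1))).length := by cases b <;> simp <;> omega
        have hpos := netDisp_take_loopWord_dir_pos hL c.dir (off i.1) (off_bounds i.1) i.2.1 i.2.2 hk1' hk2'
        have := h0 c.dir
        rw [this] at hpos
        exact lt_irrefl _ hpos
      · -- on the closing line: the letter is `−e_μ`
        rw [List.getElem?_append_right h3, List.getElem?_replicate] at hk
        by_cases h4 : k - (stairWord i.2.1 (off i.1)).length - P.L - (wordRev (stairWord i.2.2 (off i.1))).length < P.L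
        · simp only [h4, if_true, Option.some.injEq, Prod.mk.injEq] at hk
          exact hν hk.1.symm
        · simp [h4] at hk

end Walks

/-! ## §3 The centre leg in the loop words: occurrence, covariant sums, loop variables -/

section Occurrence

variable {P : Params} {j : ℕ}

/-- **NO STEP OF THE TAIL IS THE CENTRE LEG.**  Write the loop word as `l₀ :: w′`; no step of the walk of `w′` from the end of the
first step is the bond `⟨emb c₋, ν⟩` (`ν ≠ c.dir`). [folklore] -/
theorem bond_ne_centreLeg_of_mem_walk_tail (hj : j + 1 ≤ P.m + P.K) (c : PBond P (j + 1)) (i : Idx P) {ν : Fin P.d}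
    (hν : ν ≠ c.dir) {l₀ : Letter P.d} {w' : List (Letter P.d)}
    (hw : loopWord P.L c.dir (off i.1) i.2.1 i.2.2 = l₀ :: w') {x : Site P j} (hx : x = walkEnd (emb c.src) [l₀])
    (s : LStep P j) (hs : s ∈ walk x w') : s.bond ≠ ⟨emb c.src, ν⟩ := by
  subst hx
  intro hse
  obtain ⟨k, hk, hwk, hsrc⟩ := exists_index_of_mem_walk _ _ s hs
  rw [hse] at hwk hsrc
  have hk' : (loopWord P.L c.dir (off i.1) i.2.1 i.2.2)[k + 1]? = some (ν, s.fwd) := by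
    rw [hw, List.getElem?_cons_succ]; exact hwk
  have hret : walkEnd (emb c.src) ((loopWord P.L c.dir (off i.1) i.2.1 i.2.2).take (if s.fwd then k + 1 else k + 1 + 1)) =
      emb c.src := by
    rw [hw]
    obtain ⟨a, b⟩ := l₀
    cases hf : s.fwd <;> cases b <;>
      simp only [hf, Bool.false_eq_true, if_false, if_true, List.take_succ_cons, walkEnd] at hsrc ⊢ <;> exact hsrc.symm
  exact Nat.succ_ne_zero k (centreLeg_index hj c i hν hk' hret).1

/-- The loop word is never empty (it contains the transported bond, `L ≥ 1` letters). [folklore] -/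
theorem loopWord_ne_nil (c : PBond P (j + 1)) (i : Idx P) : loopWord P.L c.dir (off i.1) i.2.1 i.2.2 ≠ [] := by
  intro h
  have := congrArg List.length h
  simp [loopWord, List.length_append, List.length_replicate] at this
  have := P.L_pos
  omega

/-- **THE FIRST LETTER.**  The loop word begins with `+e_ν` (`ν ≠ c.dir`) iff its staircase `Γ` does. [folklore] -/
theorem loopWord_head_eq_iff (c : PBond P (j + 1)) (i : Idx P) {ν : Fin P.d} (hν : ν ≠ c.dir) :
    (loopWord P.L c.dir (off i.1) i.2.1 i.2.2).head? = some (ν, true) ↔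
      (stairWord i.2.1 (off i.1)).head? = some (ν, true) := by
  unfold loopWord
  cases hΓ : stairWord i.2.1 (off i.1) with
  | nil =>
    have hL := P.L_pos
    obtain ⟨L', hL'⟩ : ∃ L', P.L = L' + 1 := ⟨P.L - 1, by omega⟩
    simp [hL', List.replicate_succ, hν.symm]
  | cons l Γ => simp

variable {G : Type*} [GaugeGroup G] [DecidableEq (PBond P j)]

/-- **THE LOOP VARIABLES UNDER A CENTRE-LEG UPDATE.**  Replacing `U(⟨emb c₋, ν⟩)` by `g · U(⟨emb c₋, ν⟩)` (`ν ≠ c.dir`) multiplies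
the loop variables of the members whose staircase starts with `+e_ν` by `g` ON THE LEFT and leaves every other loop variable at
`c` unchanged: the centre leg is a common first factor of exactly those members. [folklore] -/
theorem loopHol_update_centreLeg (hj : j + 1 ≤ P.m + P.K) (U : GaugeField P j G) (c : PBond P (j + 1)) {ν : Fin P.d}
    (hν : ν ≠ c.dir) (g : G) (i : Idx P) :
    loopHol (Function.update U ⟨emb c.src, ν⟩ (g * U ⟨emb c.src, ν⟩)) c i =
      if (stairWord i.2.1 (off i.1)).head? = some (ν, true) then g * loopHol U c i else loopHol U c i := by
  obtain ⟨l₀, w', hw⟩ := List.exists_cons_of_ne_nil (loopWord_ne_nil c i)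
  have hhead : (stairWord i.2.1 (off i.1)).head? = some (ν, true) ↔ l₀ = (ν, true) := by
    rw [← loopWord_head_eq_iff c i hν, hw, List.head?_cons, Option.some.injEq]
  have htail : ∀ x, (∀ s ∈ walk x w', s.bond ≠ (⟨emb c.src, ν⟩ : PBond P j)) →
      holAt (Function.update U ⟨emb c.src, ν⟩ (g * U ⟨emb c.src, ν⟩)) (walk x w') = holAt U (walk x w') :=
    fun x hx => T4ReflectionCone.holAt_congr fun s hs => Function.update_of_ne (hx s hs) _ _
  unfold loopHol
  rw [hw]
  obtain ⟨a, b⟩ := l₀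
  cases b
  · -- first letter `−e_a`: the first step is `⟨emb c₋ − e_a, a⟩`, never the centre leg
    have hne : (⟨(emb c.src).unshift a, a⟩ : PBond P j) ≠ ⟨emb c.src, ν⟩ := by
      intro h
      have h1 : a = ν := (PBond.mk.injEq _ _ _ _ ▸ h :).2
      subst h1
      exact unshift_emb_ne hj c.src a ((PBond.mk.injEq _ _ _ _ ▸ h :).1)
    have hif : ¬ (stairWord i.2.1 (off i.1)).head? = some (ν, true) := by rw [hhead]; simp
    rw [if_neg hif]
    simp only [walk, holAt_cons, Bool.false_eq_true, if_false]
    rw [Function.update_of_ne hne, (htail _ fun s hs => bond_ne_centreLeg_of_mem_walk_tail hj c i hν hw (by simp [walkEnd]) s hs)]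
  · simp only [walk, holAt_cons, if_true]
    rw [(htail _ fun s hs => bond_ne_centreLeg_of_mem_walk_tail hj c i hν hw (by simp [walkEnd]) s hs)]
    by_cases ha : a = ν
    · subst ha
      rw [if_pos (hhead.mpr rfl), Function.update_self, mul_assoc]
    · have hne : (⟨emb c.src, a⟩ : PBond P j) ≠ ⟨emb c.src, ν⟩ := fun h => ha (PBond.mk.injEq _ _ _ _ ▸ h :).2
      have hif : ¬ (stairWord i.2.1 (off i.1)).head? = some (ν, true) := by
        rw [hhead]; simp [ha]
      rw [if_neg hif, Function.update_of_ne hne]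

/-- The coarse bond variable `U(c)` (the straight-line transporter) does not see the centre leg `⟨emb c₋, ν⟩`, `ν ≠ c.dir`. [folklore] -/
theorem axialAvg_update_centreLeg (U : GaugeField P j G) (c : PBond P (j + 1)) {ν : Fin P.d} (hν : ν ≠ c.dir) (v : G) :
    axialAvg (Function.update U ⟨emb c.src, ν⟩ v) c = axialAvg U c := by
  rw [axialAvg_eq_holAt_walk, axialAvg_eq_holAt_walk]
  refine T4ReflectionCone.holAt_congr fun s hs => Function.update_of_ne (fun h => ?_) _ _
  have hmem := BlockAveragingHaarAC.letter_mem_of_mem_walk _ _ s hs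
  rw [List.mem_replicate] at hmem
  have : s.bond.dir = c.dir := (Prod.mk.injEq _ _ _ _ ▸ hmem.2 :).1
  rw [h] at this
  exact hν this


/-- **THE CENTRE LEG IS TRAVERSED**: some member's staircase starts with `+e_ν` (offset `n_ν = h ≥ 1` — the block size is an odd
`L ≥ 3` — and an ordering that puts `ν` first). [folklore] -/
theorem exists_centreLeg_member (ν : Fin P.d) : ∃ i : Idx P, (stairWord i.2.1 (off i.1)).head? = some (ν, true) := by
  classical
  have hL := two_mul_half_add_one P
  obtain ⟨k₀, hk₀⟩ := P.hL.1
  have hL1 := P.hL.2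
  have hh1 : 1 ≤ (P.L - 1) / 2 := by omega
  let r : Fin P.d → Fin P.L := fun κ => if κ = ν then ⟨P.L - 1, by omega⟩ else ⟨(P.L - 1) / 2, by omega⟩
  let σ : Equiv.Perm (Fin P.d) := Equiv.swap ⟨0, P.hd⟩ ν
  refine ⟨(r, σ, 1), ?_⟩
  show (stairRuns (off r) ((List.finRange P.d).map σ)).head? = some (ν, true)
  have hne : (List.finRange P.d).map σ ≠ [] := by
    have := P.hd
    rw [ne_eq, List.map_eq_nil_iff, ← List.length_eq_zero_iff, List.length_finRange]
    omega
  obtain ⟨a, as, has⟩ := List.exists_cons_of_ne_nil hne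
  have ha : a = ν := by
    have h0 : ((List.finRange P.d).map σ).head? = some (σ ⟨0, P.hd⟩) := by
      rw [List.head?_eq_getElem?, List.getElem?_map, List.getElem?_eq_getElem (by simp; exact P.hd)]
      simp [List.getElem_finRange, σ]
    rw [has, List.head?_cons, Option.some.injEq] at h0
    rw [h0]
    exact Equiv.swap_apply_left _ _
  have hoff : off r ν = (((P.L - 1) / 2 : ℕ) : ℤ) := by
    simp only [off, r, if_true]
    push_cast
    omega
  rw [has, stairRuns, ha, hoff, axisRun]
  obtain ⟨h', hh'⟩ : ∃ h', (P.L - 1) / 2 = h' + 1 := ⟨(P.L - 1) / 2 - 1, by omega⟩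
  have hnat : (((h' + 1 : ℕ) : ℤ)).natAbs = h' + 1 := Int.natAbs_natCast _
  have hdec : decide ((0 : ℤ) ≤ ((h' + 1 : ℕ) : ℤ)) = true := by simp; positivity
  rw [hh', hnat, hdec, List.replicate_succ, List.cons_append, List.head?_cons]

/-- Under a centre-leg update the loop variables at `c` move by at most `dist1 g`: the background smallness `α` of the expansion
degrades to `α + dist1 g` — what the TWO-POINT use of `centreLeg_response` (the expansion at the moved background) consumes. [folklore] -/
theorem dist1_loopHol_update_centreLeg_le (hj : j + 1 ≤ P.m + P.K) (U : GaugeField P j G)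
    (c : PBond P (j + 1)) {ν : Fin P.d} (hν : ν ≠ c.dir) (g : G) (i : Idx P) :
    dist1 (loopHol (Function.update U ⟨emb c.src, ν⟩ (g * U ⟨emb c.src, ν⟩)) c i) ≤ dist1 g + dist1 (loopHol U c i) := by
  classical
  rw [loopHol_update_centreLeg hj U c hν g i]
  split_ifs
  · exact GaugeGroup.dist1_mul_le _ _
  · have := GaugeGroup.dist1_nonneg g; linarith

/-- **`s′ ≥ 1`**: the count in `centreLeg_response` is positive. [folklore] -/
theorem one_le_card_centreLeg (ν : Fin P.d) :
    1 ≤ (Finset.univ.filter fun i : Idx P => (stairWord i.2.1 (off i.1)).head? = some (ν, true)).card := by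
  classical
  obtain ⟨i, hi⟩ := exists_centreLeg_member (P := P) ν
  exact Finset.card_pos.mpr ⟨i, Finset.mem_filter.mpr ⟨Finset.mem_univ _, hi⟩⟩

end Occurrence

end Summit.QuantumFields.YangMills.Theorems.FluctuationComparisonRegPrIntLS1aCentreLegOccurrence

end
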